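import Summits.PneNP.PneNP.Theorems.ConvexRankGatesConvexGateBlindExactLiftingTriangleIsolationKernel

/-!
# Triangle instance — the averaged cube identity for an ARBITRARY factorisation of `M_t − εJ`

Support file for crux `ConvexGateBlind` (stmt-PneNP-10680), open stub `stub_exactLifting`; prover seat 0, session 22, memo
ANALYSIS12 §3.4 / §7. The cube-inequality dual `ψ^x` (weights `wt x w = ± dc₀dc₁dc₂`, file `…IsolationKernel`) kills every
row of `M_t` (`ψ^x(M_x) = 0`) and has total `ψ^x(1) = 4μ(x)`. Hence for ANY non-negative factorisation
`M_t − εJ = ∑_l u_l ⊗ v_l` (any index type, any number of terms, no closeness hypothesis):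

  `∑_l ∑_x u_l(x) · ψ^x(v_l) = −4ε · ∑_x μ(x)`   (`cube_identity`),

i.e. with the USAGE KERNEL `κ_l(w) = ∑_x u_l(x) wt x w` of the term `l`: `∑_l ⟨v_l, κ_l⟩ = −4ε M`. A strict factorisation
(`ε > 0`) must therefore place generator mass where its own usage kernel is negative — on triangles that are monochromatic
for (a class-size-weighted) majority of the rows using the term; lines have `κ_L ≥ 0` with equality exactly on `L`
(`…IsolationKernelTwo`). This is the first-moment identity behind Theorem B; globally it is a mass statement (ε-linear),
recorded here in reusable form (`triangle_cube_identity`, registered, self-contained signature).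
-/

set_option linter.dupNamespace false -- `Summit.PneNP.PneNP.…`: summit = sub-problem (D-0017)

namespace Summit.PneNP.PneNP.Theorems.XorDoor.TriLine

open Finset

noncomputable section

variable {t : ℕ}

/-- **The averaged cube identity** for an arbitrary non-negative factorisation of `M_t − εJ`
(non-negativity is not even needed: it is a linear identity). -/
theorem cube_identity {ι : Type} [Fintype ι] (ε : ℝ) (u : ι → Col t → ℝ) (v : ι → Tri t → ℝ)
    (hfact : ∀ x w, ∑ l, u l x * v l w = (monoCount x w : ℝ) - ε) :
    ∑ l, ∑ x : Col t, u l x * ∑ w : Tri t, wt x w * v l w = -4 * ε * ∑ x : Col t, mu x := by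
  have hx : ∀ x : Col t, ∑ l, u l x * ∑ w : Tri t, wt x w * v l w = -4 * ε * mu x := by
    intro x
    calc ∑ l, u l x * ∑ w : Tri t, wt x w * v l w = ∑ w : Tri t, wt x w * ∑ l, u l x * v l w := by
          simp only [mul_sum]
          rw [sum_comm]
          refine sum_congr rfl fun w _ => sum_congr rfl fun l _ => ?_
          ring
      _ = ∑ w : Tri t, wt x w * ((monoCount x w : ℝ) - ε) := sum_congr rfl fun w _ => by rw [hfact x w]
      _ = ∑ w : Tri t, wt x w * (monoCount x w : ℝ) - ε * ∑ w : Tri t, wt x w := by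
          rw [mul_sum, ← sum_sub_distrib]
          refine sum_congr rfl fun w _ => ?_
          ring
      _ = -4 * ε * mu x := by rw [sum_wt_monoCount, sum_wt]; ring
  rw [sum_comm]
  simp only [hx, ← mul_sum]

/-- **The averaged cube identity, self-contained form** — registered sub-goal `triangle_cube_identity` of stmt-PneNP-10680,
verbatim signature: for any real factorisation `∑_l u_l(x) v_l(w) = M_t[x,w] − ε` indexed by a finite type,
`∑_l ∑_x u_l(x) ∑_w (±N₀N₁N₂)(x,w) v_l(w) = −4ε ∑_x μ(x)`, the sign being `−` exactly on the monochromatic triangles,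
`Nᵢ` the number of vertices of block `i` coloured unlike `wᵢ`, `μ(x) = ∏ blocks #A·#B`. -/
theorem triangle_cube_identity : ∀ (t : ℕ) (ι : Type) [Fintype ι] (ε : ℝ) (u : ι → (Fin t → Bool) × (Fin t → Bool) × (Fin t
    → Bool) → ℝ) (v : ι → Fin t × Fin t × Fin t → ℝ), (∀ x w, ∑ l, u l x * v l w = ((if x.1 w.1 = x.2.1 w.2.1 then 1 else
    0) + (if x.1 w.1 = x.2.2 w.2.2 then 1 else 0) + (if x.2.1 w.2.1 = x.2.2 w.2.2 then 1 else 0) : ℝ) - ε) → ∑ l, ∑ x : (Fin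
    t → Bool) × (Fin t → Bool) × (Fin t → Bool), u l x * ∑ w : Fin t × Fin t × Fin t, (if x.1 w.1 = x.2.1 w.2.1 ∧ x.1 w.1
    = x.2.2 w.2.2 then (-1 : ℝ) else 1) * ((Finset.univ.filter fun v => x.1 v ≠ x.1 w.1).card : ℝ) * ((Finset.univ.filter
    fun v => x.2.1 v ≠ x.2.1 w.2.1).card : ℝ) * ((Finset.univ.filter fun v => x.2.2 v ≠ x.2.2 w.2.2).card : ℝ) * v l w =
    -4 * ε * ∑ x : (Fin t → Bool) × (Fin t → Bool) × (Fin t → Bool), (((Finset.univ.filter fun v => x.1 v = true).card *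
    (Finset.univ.filter fun v => x.1 v = false).card : ℕ) : ℝ) * (((Finset.univ.filter fun v => x.2.1 v =
    true).card * (Finset.univ.filter fun v => x.2.1 v = false).card : ℕ) : ℝ) * (((Finset.univ.filter fun v => x.2.2
    v = true).card * (Finset.univ.filter fun v => x.2.2 v = false).card : ℕ) : ℝ) := by
  intro t ι _ ε u v hfact
  have hf : ∀ x w, ∑ l, u l x * v l w = (monoCount x w : ℝ) - ε := by
    intro x w; rw [hfact x w]; simp only [monoCount]; push_cast; ring
  have h := cube_identity ε u v hf
  unfold wt sgn nw mu IsMono dc cp cls at h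
  rw [← h]
  refine sum_congr rfl fun l _ => sum_congr rfl fun x _ => ?_
  congr 1
  refine sum_congr rfl fun w _ => ?_
  ring

end

end Summit.PneNP.PneNP.Theorems.XorDoor.TriLine
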